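import Summits.CriticalPhenomena.SAWScalingLimit.Theorems.SAWLoopFugacityFlowIsingBoundaryRatioHeartAssembly
import Literature.Probability.LatticeModels.ScaleFrameRatioForgettingFinal
import Literature.Probability.LatticeModels.ScaleFrameTwoGraphs
import HarnessLib

/-!
# The FK heart of the line `fk-anchor-transfer` (crux `SAWLoopFugacityFlow.IsingBoundaryRatio`, stmt-CriticalPhenomena-10650):
the registered stub `stub_fkArmOriginForgettingBS`, unconditionally

The assembly `fkArmOriginForgettingBS_of` (file `…HeartAssembly`) applied to the two landed abstract bricks of Kesten's
ratio-limit scheme over scale frames: Kesten's one-frame ratio forgetting `ScaleFrame.insideRatio_osc_le` (Hopf–Doeblin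
contraction over the Off-wired exploration data, kernel cross-ratios `kernel_crossRatio_le`) and the two-graph comparison
across a window `ScaleFrame.ratio_forgetting_two_graphs`. Folklore bookkeeping; no new definitions.
-/

noncomputable section

open scoped Classical Topology
open Filter Set Metric SimpleGraph MeasureTheory Finset
open Literature.Probability.LatticeModels Literature.Probability.RandomPlanarGeometry
open Literature.Probability.Percolation (BondConfig openConn openConnIn openCrossing explEvent)
open UpperHalfPlane (upperHalfPlaneSet)

namespace Summit.CriticalPhenomena.SAWScalingLimit.Theorems.IsingBoundaryRatio

/-- **The FK heart** (registered stub `stub_fkArmOriginForgettingBS` of the line `fk-anchor-transfer`): arm-origin forgetting for the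
free critical FK–Ising connection probabilities at the marked prime end `a = D.pt 0` of every Dobrushin domain, uniformly over
finite supergraphs agreeing locally with the mesh graph — from chart-annulus separation, the mesh RSW statements (i)–(ii)
(`RoughHalfAnnulusRSWMeshLargeOf AnnPathSepG`), the radial crossing bound (iii) (`HalfAnnulusRadialCrossingBoundFat`) and the
conditional-cylinder RSW (unused by this route). Proof: `fkArmOriginForgettingBS_of` with the landed
`ScaleFrame.insideRatio_osc_le` and `ScaleFrame.ratio_forgetting_two_graphs`. [folklore] -/
theorem stub_fkArmOriginForgettingBS :
    ChartAnnulusSeparation → RoughHalfAnnulusRSWMeshLargeOf AnnPathSepG → HalfAnnulusRadialCrossingBoundFat →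
      RoughHalfAnnulusRSWLargeOf AnnPathSepG →
      ∀ (D : DobrushinDomain), FKArmOriginForgettingAt D.carrier (D.pt 0) :=
  fkArmOriginForgettingBS_of ScaleFrame.insideRatio_osc_le ScaleFrame.ratio_forgetting_two_graphs

end Summit.CriticalPhenomena.SAWScalingLimit.Theorems.IsingBoundaryRatio

end
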